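import Summits.AtomisticToContinuum.BoseEinsteinCondensation.Theorems.SoloBlindImaginaryGaugeField
import Mathlib.Analysis.SpecificLimits.Normed

/-!
# SoloBlind — the zero-free strip of the twisted Villain / rotor weight

Solo-blind `AtomisticToContinuum / BoseEinsteinCondensation`, census line N16 (C3 typed), claim C138.

The Poisson-dual (Villain) form of the rotor temporal transfer weight at filling `ν`,
`Σ_{k∈ℤ} exp(−(φ+2πk)²/(2t) + iν(φ+2πk))` (`villainTwisted`, K12 / C121), is the Villain weight at
the COMPLEX twist `φ − i t ν`: real part `φ` (a U(1) kick / twisted boundary condition), imaginary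
part `−tν` (the filling, an exponential tilt of the current). We prove that it has NO zeros in the
strip `|φ| ≤ π − δ` as soon as `exp(−2πδ/t) < 1/3` (i.e. `δ > t·ln 3/(2π)`), for EVERY filling `ν`
(`villainTwisted_ne_zero`, `rotorWeight_ne_zero`): the `k = 0` term dominates the sum of all the
others by the factor `2q/(1−q) < 1`, `q = exp(−2πδ/t)`, because `(φ+2πk)² ≥ φ² + 4πδ|k|` on the strip
(`sq_shift_ge`). At the edge `φ = π` the two dominant terms `k = 0, −1` have equal modulus and cancel
exactly at half-integer filling (`villainTwistedTerm_pi_cancel_half_int`): the zeros of the twisted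
weight sit at real twist `π`, never before — the complex-twist shadow of the level crossing at twist
`π` (LSSY05 Thm 5.3, Remark 3) and the twist-plane form of Fröhlich–Spencer's current-plane strip
`|Im h| ≤ β/2` (CMP 81 (1981) §6, App. B).
No axioms beyond Mathlib; sorry-free.
-/

open Complex

namespace Summit.AtomisticToContinuum.BoseEinsteinCondensation.Theorems

/-- The modulus of the `k`-th twisted Villain term does not see the filling:
`‖exp(−(φ+2πk)²/(2t) + iν(φ+2πk))‖ = exp(−(φ+2πk)²/(2t))`. -/
theorem norm_villainTwistedTerm (t ν φ : ℝ) (k : ℤ) :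
    ‖villainTwistedTerm t ν φ k‖ = Real.exp (-(φ + 2 * Real.pi * k) ^ 2 / (2 * t)) := by
  unfold villainTwistedTerm
  have h : (-((φ : ℂ) + 2 * Real.pi * k) ^ 2 / (2 * t) + I * ν * ((φ : ℂ) + 2 * Real.pi * k))
      = ((-(φ + 2 * Real.pi * k) ^ 2 / (2 * t) : ℝ) : ℂ)
        + I * ((ν * (φ + 2 * Real.pi * k) : ℝ) : ℂ) := by
    push_cast
    ring
  rw [h, Complex.norm_exp, Complex.add_re, Complex.ofReal_re, Complex.mul_re, Complex.I_re, Complex.I_im,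
    Complex.ofReal_re, Complex.ofReal_im]
  norm_num

/-- The elementary strip inequality: for `|φ| ≤ π − δ`, `0 ≤ δ ≤ π` and every integer `k`,
`(φ + 2πk)² ≥ φ² + 4πδ|k|`. -/
theorem sq_shift_ge {φ δ : ℝ} (hδ : 0 ≤ δ) (hδπ : δ ≤ Real.pi) (hφ : |φ| ≤ Real.pi - δ)
    (k : ℤ) :
    φ ^ 2 + 4 * Real.pi * δ * |(k : ℝ)| ≤ (φ + 2 * Real.pi * k) ^ 2 := by
  have hπ : 0 < Real.pi := Real.pi_pos
  have hφ1 : φ ≤ Real.pi - δ := (abs_le.mp hφ).2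
  have hφ2 : -(Real.pi - δ) ≤ φ := (abs_le.mp hφ).1
  rcases lt_trichotomy k 0 with hk | hk | hk
  · have hk' : (k : ℝ) ≤ -1 := by exact_mod_cast (Int.le_sub_one_of_lt hk)
    rw [abs_of_neg (by linarith)]
    nlinarith [mul_nonneg hπ.le hδ, mul_nonneg hπ.le (show 0 ≤ -(k:ℝ) - 1 by linarith)]
  · subst hk
    simp
  · have hk' : (1 : ℝ) ≤ k := by exact_mod_cast hk
    rw [abs_of_pos (by linarith)]
    nlinarith [mul_nonneg hπ.le hδ, mul_nonneg hπ.le (show 0 ≤ (k:ℝ) - 1 by linarith)]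

/-- Term-wise domination by the `k = 0` term times a geometric factor:
`‖T_k‖ ≤ ‖T_0‖ · exp(−2πδ/t)^{|k|}` on the strip. -/
theorem norm_villainTwistedTerm_le {t δ φ : ℝ} (ht : 0 < t) (hδ : 0 ≤ δ) (hδπ : δ ≤ Real.pi)
    (hφ : |φ| ≤ Real.pi - δ) (ν : ℝ) (k : ℤ) :
    ‖villainTwistedTerm t ν φ k‖ ≤
      Real.exp (-φ ^ 2 / (2 * t)) * Real.exp (-(2 * Real.pi * δ / t)) ^ k.natAbs := by
  rw [norm_villainTwistedTerm]
  have ht2 : 0 < 2 * t := by linarith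
  have hs := sq_shift_ge hδ hδπ hφ k
  have hk : ((k.natAbs : ℕ) : ℝ) = |(k : ℝ)| := by
    rw [Nat.cast_natAbs, Int.cast_abs]
  have step1 : Real.exp (-(φ + 2 * Real.pi * k) ^ 2 / (2 * t))
      ≤ Real.exp (-(φ ^ 2 + 4 * Real.pi * δ * |(k : ℝ)|) / (2 * t)) := by
    apply Real.exp_le_exp.mpr
    rw [div_le_div_iff_of_pos_right ht2]
    linarith
  have step2 : Real.exp (-(φ ^ 2 + 4 * Real.pi * δ * |(k : ℝ)|) / (2 * t))
      = Real.exp (-φ ^ 2 / (2 * t)) * Real.exp (-(2 * Real.pi * δ / t)) ^ k.natAbs := by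
    rw [← Real.exp_nat_mul, ← Real.exp_add, hk]
    congr 1
    field_simp
    ring
  exact step1.trans step2.le

/-- If `t·ln 3 < 2πδ` then `exp(−2πδ/t) < 1/3` (the hypothesis of the zero-free strip in the
form "`δ` exceeds `t ln 3/(2π)`"). -/
theorem exp_lt_third_of {t δ : ℝ} (ht : 0 < t) (h : t * Real.log 3 < 2 * Real.pi * δ) :
    Real.exp (-(2 * Real.pi * δ / t)) < 1 / 3 := by
  have h3 : Real.exp (-Real.log 3) = 1 / 3 := by
    rw [Real.exp_neg, Real.exp_log (by norm_num : (0:ℝ) < 3), one_div]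
  rw [← h3, Real.exp_lt_exp, neg_lt_neg_iff, lt_div_iff₀ ht]
  linarith [mul_comm t (Real.log 3)]

/-- **K14 / C138 (zero-free strip).** For `t > 0`, `0 < δ ≤ π`, `|φ| ≤ π − δ` and `exp(−2πδ/t) < 1/3`,
the twisted Villain sum `Σ_k exp(−(φ+2πk)²/(2t) + iν(φ+2πk))` is non-zero for EVERY real `ν`:
the `k = 0` term beats all the others, `‖Σ_{k≠0} T_k‖ ≤ 2q/(1−q)·‖T_0‖ < ‖T_0‖`, `q = exp(−2πδ/t)`. -/
theorem villainTwisted_tsum_ne_zero {t δ φ : ℝ} (ht : 0 < t) (hδ : 0 < δ) (hδπ : δ ≤ Real.pi)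
    (hφ : |φ| ≤ Real.pi - δ) (hq : Real.exp (-(2 * Real.pi * δ / t)) < 1 / 3) (ν : ℝ) :
    ∑' k : ℤ, villainTwistedTerm t ν φ k ≠ 0 := by
  set q : ℝ := Real.exp (-(2 * Real.pi * δ / t)) with hqdef
  set T : ℤ → ℂ := villainTwistedTerm t ν φ with hT
  set A : ℝ := Real.exp (-φ ^ 2 / (2 * t)) with hA
  have hq0 : 0 ≤ q := (Real.exp_pos _).le
  have hq1 : q < 1 := by linarith
  have hA0 : 0 < A := Real.exp_pos _
  -- norm of the dominant term
  have hT0 : ‖T 0‖ = A := by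
    rw [hT, norm_villainTwistedTerm]
    simp [hA]
  -- geometric majorants for the two tails
  have hbound : ∀ k : ℤ, ‖T k‖ ≤ A * q ^ k.natAbs := fun k =>
    norm_villainTwistedTerm_le ht hδ.le hδπ hφ ν k
  have hgeo : HasSum (fun n : ℕ => A * q ^ (n + 1)) (A * (q / (1 - q))) := by
    have h1 : HasSum (fun n : ℕ => q ^ n) (1 - q)⁻¹ := hasSum_geometric_of_lt_one hq0 hq1
    have h2 : HasSum (fun n : ℕ => (A * q) * q ^ n) ((A * q) * (1 - q)⁻¹) := h1.mul_left (A * q)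
    have hfun : (fun n : ℕ => A * q ^ (n + 1)) = (fun n : ℕ => (A * q) * q ^ n) := by
      funext n; ring
    have hval : A * (q / (1 - q)) = (A * q) * (1 - q)⁻¹ := by rw [div_eq_mul_inv]; ring
    rw [hfun, hval]; exact h2
  have hpos : ∀ n : ℕ, ‖T ((n : ℤ) + 1)‖ ≤ A * q ^ (n + 1) := fun n => by
    have := hbound ((n : ℤ) + 1)
    have hn : ((n : ℤ) + 1).natAbs = n + 1 := by
      have : ((n : ℤ) + 1) = ((n + 1 : ℕ) : ℤ) := by push_cast; ring
      rw [this, Int.natAbs_natCast]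
    rwa [hn] at this
  have hneg : ∀ n : ℕ, ‖T (-((n : ℤ) + 1))‖ ≤ A * q ^ (n + 1) := fun n => by
    have := hbound (-((n : ℤ) + 1))
    have hn : (-((n : ℤ) + 1)).natAbs = n + 1 := by
      rw [Int.natAbs_neg]
      have : ((n : ℤ) + 1) = ((n + 1 : ℕ) : ℤ) := by push_cast; ring
      rw [this, Int.natAbs_natCast]
    rwa [hn] at this
  -- the two tails are summable with norm ≤ A q/(1-q)
  have hsumP : Summable (fun n : ℕ => T ((n : ℤ) + 1)) :=
    Summable.of_norm_bounded hgeo.summable hpos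
  have hsumN : Summable (fun n : ℕ => T (-((n : ℤ) + 1))) :=
    Summable.of_norm_bounded hgeo.summable hneg
  have hnormP : ‖∑' n : ℕ, T ((n : ℤ) + 1)‖ ≤ A * (q / (1 - q)) := tsum_of_norm_bounded hgeo hpos
  have hnormN : ‖∑' n : ℕ, T (-((n : ℤ) + 1))‖ ≤ A * (q / (1 - q)) := tsum_of_norm_bounded hgeo hneg
  -- assemble the ℤ-indexed sum: Σ_ℤ T = T 0 + Σ_{n≥0} T(n+1) + Σ_{n≥0} T(-(n+1))
  have hnat : HasSum (fun n : ℕ => T (n : ℤ)) (T 0 + ∑' n : ℕ, T ((n : ℤ) + 1)) := by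
    have hfun : (fun n : ℕ => T (((n + 1 : ℕ) : ℤ))) = (fun n : ℕ => T ((n : ℤ) + 1)) := by
      funext n
      simp only [Nat.cast_add, Nat.cast_one]
    have h'' : HasSum (fun n : ℕ => (fun m : ℕ => T (m : ℤ)) (n + 1)) (∑' n : ℕ, T ((n : ℤ) + 1)) := by
      show HasSum (fun n : ℕ => T (((n + 1 : ℕ) : ℤ))) _
      rw [hfun]
      exact hsumP.hasSum
    have h3 := (hasSum_nat_add_iff (f := fun m : ℕ => T (m : ℤ)) 1).mp h''
    simpa [Finset.sum_range_one, add_comm] using h3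
  have hint : HasSum T (T 0 + ∑' n : ℕ, T ((n : ℤ) + 1) + ∑' n : ℕ, T (-((n : ℤ) + 1))) :=
    HasSum.of_nat_of_neg_add_one hnat hsumN.hasSum
  rw [hint.tsum_eq]
  -- dominant term beats the tails
  intro hzero
  have hq3 : 2 * (A * (q / (1 - q))) < A := by
    have h1q : 0 < 1 - q := by linarith
    have : 2 * q < 1 - q := by linarith
    have : q / (1 - q) < 1 / 2 := by
      rw [div_lt_iff₀ h1q]; linarith
    nlinarith
  have : ‖T 0‖ ≤ ‖∑' n : ℕ, T ((n : ℤ) + 1)‖ + ‖∑' n : ℕ, T (-((n : ℤ) + 1))‖ := by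
    have hT0eq : T 0 = -(∑' n : ℕ, T ((n : ℤ) + 1) + ∑' n : ℕ, T (-((n : ℤ) + 1))) := by
      linear_combination hzero
    rw [hT0eq, norm_neg]
    exact norm_add_le _ _
  rw [hT0] at this
  linarith

/-- The twisted Villain weight `villainTwisted t ν φ` (K12) has no zeros on the strip. -/
theorem villainTwisted_ne_zero {t δ φ : ℝ} (ht : 0 < t) (hδ : 0 < δ) (hδπ : δ ≤ Real.pi)
    (hφ : |φ| ≤ Real.pi - δ) (hq : Real.exp (-(2 * Real.pi * δ / t)) < 1 / 3) (ν : ℝ) :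
    villainTwisted t ν φ ≠ 0 := by
  unfold villainTwisted
  refine mul_ne_zero ?_ (villainTwisted_tsum_ne_zero ht hδ hδπ hφ hq ν)
  have : 0 < Real.sqrt (2 * Real.pi / t) := Real.sqrt_pos.mpr (by positivity)
  exact_mod_cast this.ne'

/-- Hence the rotor temporal transfer weight `Σ_n exp(inφ − t(n−ν)²/2)` never vanishes for
`|φ| ≤ π − δ`, `δ > t ln 3/(2π)`, at ANY filling `ν`. -/
theorem rotorWeight_ne_zero {t δ φ : ℝ} (ht : 0 < t) (hδ : 0 < δ) (hδπ : δ ≤ Real.pi)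
    (hφ : |φ| ≤ Real.pi - δ) (hq : Real.exp (-(2 * Real.pi * δ / t)) < 1 / 3) (ν : ℝ) :
    rotorWeight t ν φ ≠ 0 := by
  rw [rotorWeight_eq_villainTwisted t ν φ ht]
  exact villainTwisted_ne_zero ht hδ hδπ hφ hq ν

/-- **Sharpness at the edge.** At `φ = π` the two dominant terms `k = 0` and `k = −1` have equal
modulus `exp(−π²/(2t))` and phases `exp(±iνπ)`; at HALF-INTEGER filling they cancel exactly. -/
theorem villainTwistedTerm_pi_cancel_half_int (t : ℝ) (m : ℤ) :
    villainTwistedTerm t (m + 1 / 2) Real.pi 0 + villainTwistedTerm t (m + 1 / 2) Real.pi (-1) = 0 := by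
  unfold villainTwistedTerm
  have h0 : (-((Real.pi : ℂ) + 2 * Real.pi * ((0 : ℤ) : ℂ)) ^ 2 / (2 * t)
      + I * (((m : ℝ) + 1 / 2 : ℝ) : ℂ) * ((Real.pi : ℂ) + 2 * Real.pi * ((0 : ℤ) : ℂ)))
      = ((-(Real.pi) ^ 2 / (2 * t) : ℝ) : ℂ) + (((m + 1 / 2) * Real.pi : ℝ) : ℂ) * I := by
    push_cast; ring
  have h1 : (-((Real.pi : ℂ) + 2 * Real.pi * ((-1 : ℤ) : ℂ)) ^ 2 / (2 * t)
      + I * (((m : ℝ) + 1 / 2 : ℝ) : ℂ) * ((Real.pi : ℂ) + 2 * Real.pi * ((-1 : ℤ) : ℂ)))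
      = ((-(Real.pi) ^ 2 / (2 * t) : ℝ) : ℂ) + -((((m + 1 / 2) * Real.pi : ℝ) : ℂ) * I) := by
    push_cast; ring
  rw [h0, h1, Complex.exp_add, Complex.exp_add, ← mul_add]
  have hcos : cexp ((((m + 1 / 2) * Real.pi : ℝ) : ℂ) * I) + cexp (-((((m + 1 / 2) * Real.pi : ℝ) : ℂ) * I))
      = 2 * Real.cos ((m + 1 / 2) * Real.pi) := by
    rw [Complex.ofReal_cos, Complex.two_cos]
    ring_nf
  rw [hcos]
  have hz : Real.cos ((m + 1 / 2) * Real.pi) = 0 := by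
    have : ((m : ℝ) + 1 / 2) * Real.pi = (m : ℝ) * Real.pi + Real.pi / 2 := by ring
    rw [this, Real.cos_add_pi_div_two, Real.sin_int_mul_pi, neg_zero]
  rw [hz]
  simp

end Summit.AtomisticToContinuum.BoseEinsteinCondensation.Theorems
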